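import Summits.Ventures.AbcSig.Rows.TemplateC
import Summits.Ventures.AbcSig.Levels.N578

/-!
# Venture AbcSig — ROW (REPRODUCTION of [BS04, §5.3, `ab` even]): `xⁿ + yⁿ = 17 z²`, `xy` even

HONEST FRAMING. A row of a COMPUTATION cell (`pub-abcsig`); a CONDITIONAL theorem, no claim on ABC or any summit.
Printed result being reproduced: [BS04, p. 42] "This completes the proof of Theorem 1.1 for `C = 17`, `xy` even and
`n ∈ {11, 13}` or `n ≥ 19` prime" (the `ab`-even half of Theorem 1.1 for `C = 17`, obtained at level `578 = 2·17²`).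
What this file PROVES (kernel-checked), via `row_template_even`: for every abstract newform model `M` and every
prime `n ≥ 7`, `n ∉ {7, 17}`,

  `BS04Package M` (CITED: [BS04] Lemma 3.3 = modularity + Cor. 3.1 + Ribet, with (3.1) and Lemma 4.2)
  `→ DataComplete M 578 level578Orbits` (COMPUTED: the nine certified orbits of `S₂^new(Γ₀(578))`, two engines agree)
  `→ Excludes M 578 orbit_578_1 (family C = 17, exponent n, xy even)` (CITED: [BS04, p. 41] form 578,1 = curve 578A
     has `j`-invariant denominator `1088 = 2⁶·17`, so Prop. 4.4 excludes it)
  `→` `xⁿ + yⁿ = 17z²` has no solution in pairwise coprime nonzero integers with `xy` even.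

Everything else is the kernel: the eight sieve certificates of `Levels/N578.lean` (`decide`) and the elementary
reductions of `Rows/TemplateC.lean`. The residual exponents `7` (orbits 578.2/578.4, field `x² − 2`) and `17`
(orbits 578.5/578.8, fields `x³ ∓ 3x² ± 1`, printed 578,7/578,8) are exactly the printed ones ([BS04] assume `n > 7`
and say they cannot eliminate `n = 17`); `n = 17` also divides `C`, a branch not typed in `BS04Package`. The
`xy`-odd half (level `9248`) is the cell's STEP-1 target and is not claimed here.
-/

namespace Summit.Ventures.AbcSig

/-- **Row `nn2-A1-B1-C17-even` (REPRODUCTION of [BS04, Thm. 1.1, C = 17, xy even]).** Conditional on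
`BS04Package` (cited), `DataComplete 578` (computed, two-engine certified) and the cited Prop. 4.4 exclusion of the
rational orbit `578.1` (curve 578A) for the exponent `n`, the equation `xⁿ + yⁿ = 17 z²` has no primitive solution
with `xy` even for any prime `n ≥ 7` with `n ≠ 7, 17`. -/
theorem row_xn_add_yn_eq_17z2_even (M : NewformModel) (hP : M.BS04Package)
    (hD : M.DataComplete 578 level578Orbits) (n : ℕ) (hn : n.Prime) (h7 : 7 ≤ n) (hres : n ∉ ([7, 17] : List ℕ))
    (hX : M.Excludes 578 orbit_578_1 (fun S => S.A = 1 ∧ S.B = 1 ∧ S.C = 17 ∧ S.n = n ∧ 2 ∣ S.a * S.b))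
    (a b c : ℤ) (heven : 2 ∣ a * b) : ¬ IsPrimitiveSolution 1 1 17 n a b c := by
  have h17 : Nat.Prime 17 := by norm_num
  have hnC : ¬ n ∣ 17 := by
    intro h
    rcases (Nat.dvd_prime h17).mp h with h1 | h1
    · exact hn.one_lt.ne' h1
    · simp only [List.mem_cons, List.not_mem_nil, or_false] at hres
      omega
  have hn7 : n ∉ ([7] : List ℕ) := by
    simp only [List.mem_cons, List.not_mem_nil, or_false] at hres ⊢
    omega
  have hn17 : n ∉ ([17] : List ℕ) := by
    simp only [List.mem_cons, List.not_mem_nil, or_false] at hres ⊢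
    omega
  exact row_template_even 17 (Nat.prime_iff.mp h17).squarefree (by decide) M hP hD n hn h7 hnC
    (level578_sieve n hn h7 (fun o => M.Excludes 578 o
      (fun S => S.A = 1 ∧ S.B = 1 ∧ S.C = 17 ∧ S.n = n ∧ 2 ∣ S.a * S.b)) hX
      (fun h => absurd h hn7) (fun h => absurd h hn7) (fun h => absurd h hn17) (fun h => absurd h hn17))
    a b c heven

end Summit.Ventures.AbcSig
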